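import Literature.Computability.AlgebraicComplexity.AS10CayleyDeterminant
import Literature.Computability.AlgebraicComplexity.PBoundedGrowth
import Summits.ValiantsHypothesis.ValiantsHypothesis.Theorems.NcLiteratureBridge
import HarnessLib

/-!
# NcDeterminantFace — the Cayley-determinant face of the noncommutative residual (Arvind–Srinivasan 2010)
(decomposition workshop `decomp-valiant`, lens 6 «restricted-models lifting axis», gen 5; supports
`DecompCycle1.PerNotSmVP`, stmt-ValiantsHypothesis-23661; critic K5d 2026-08-29T22:51:54Z: "cite the
Arvind–Srinivasan face in the dossier: 'is the Cayley determinant nc-circuit-easy?' is `NcLift`'s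
cheapest concrete instance")

THE FACE. On the commutativity dial (`NcSemantics`: `S ⟺ A_nc ∧ B_nc`, `A_nc = PerNotNcVP` = "the ordered
permanent has no polynomial-size noncommutative circuits", `B_nc = NcLift` its exact residual) the
DETERMINANT gives a second, strictly more concrete face. Commutatively `det ∈ VP`, so noncommutative
hardness of the ORDERED (Cayley) DETERMINANT `ncDetPoly` is not settled by the summit by itself — but
Arvind–Srinivasan proved that a small noncommutative circuit for the Cayley determinant of order `2n`
yields a small noncommutative circuit for the Cayley permanent of order `n` (Literature named fact
`AS10_thm_10`, file `AS10CayleyDeterminant.lean`). Hence, modulo that fact: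

* `ncDetHard_of_perNotNcVP : AS10_thm_10 ℂ → A_nc → NcDetHard`, so `S ⟹ A_nc ⟹ NcDetHard`
  (`ncDetHard_of_vh`): NONCOMMUTATIVE HARDNESS OF THE CAYLEY DETERMINANT IS A NECESSARY CONDITION FOR
  `VP ≠ VNP` — a WEAKER·NECESSARY piece two kernel/fact steps below the summit whose commutative
  shadow `det ∉ VP` is FALSE (`complexity_detPoly_le_of_nc`: an nc circuit for `ncDetPoly` is a
  commutative circuit for `det`), so every proof of it must see the order of multiplication;
* `DetLift := VP = VNP → (Cayley det has poly nc circuits)` is its exact residual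
  (`detLift_iff_residual`, `closes_det`, `summit_iff_det_split`), and
  `ncLift_of_detLift : AS10_thm_10 ℂ → DetLift → NcLift` — the determinant residual is the STRONGER
  one (zero-sum declared: what `NcDetHard` sheds relative to `A_nc`, `DetLift` must carry);
* the decided rung below `NcDetHard` is Nisan's: the Cayley determinant needs noncommutative ABPs of
  width `C(n,⌊n/2⌋)` at the middle layer, exactly like the permanent (`Theorems/NisanDeterminant.lean`,
  kernel, gen 4) — the rank method is DET-BLIND at the ABP level, and the open gap `ncABP → nc circuit`
  is the same gap as for `A_nc` (HWY10 §1.1; AS10 §1: "no explicit lower bounds are known for the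
  general noncommutative circuit model").

SECOND ROAD (Boolean, cited only): AS10 Thm 11 — a polynomial-time algorithm for the `2n × 2n` Cayley
determinant over `M_{cn²}(F)` gives one for the `n × n` permanent over `F`; Chien–Harsha–Sinclair–
Srinivasan (STOC 2011) and Bläser (ICALP 2013) push the `#P`-hardness to `M_2(F)` / all division-free
noncommutative algebras. Needs Boolean counting classes at this node; dossier only.

HONEST FRAMING: `NcDetHard`, `A_nc`, `DetLift`, `NcLift` are OPEN; nothing here is evidence for
`VP ≠ VNP`. The face is a typed candidate aside for the route dossier (the critic decides); it owns a
kernel rung (Nisan, determinant version) and a theorem-input (`AS10_thm_10`).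

## References

* [ArvindSrinivasan2010] V. Arvind, S. Srinivasan, *On the hardness of the noncommutative determinant*,
  STOC 2010, 677–686 (arXiv:0910.2370), §1, §4 Thm 10 (`thm_cayley_ckt`), Thm 11.
* [Nisan1991Noncommutative] N. Nisan, *Lower bounds for non-commutative computation*, STOC 1991, Thm 1.
* [HrubesWigdersonYehudayoff2010] P. Hrubeš, A. Wigderson, A. Yehudayoff, STOC 2010, §1.1.
* [Burgisser2000] P. Bürgisser, *Completeness and Reduction in Algebraic Complexity Theory*, Def. 2.1, (2.1).
-/

noncomputable section

namespace Summit.ValiantsHypothesis.ValiantsHypothesis.Theorems.NcDeterminantFace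

open Literature.Computability.AlgebraicComplexity
open Summit.ValiantsHypothesis.ValiantsHypothesis.Theorems

/-! ## §1 The commutative shadow of the ordered determinant is easy -/

/-- An nc circuit of size `≤ s` for the ordered determinant is a commutative circuit of size `≤ s` for
`det`: `L(det_n) ≤ s` — the commutative shadow of `NcDetHard` is FALSE territory (`det ∈ VP`).
[cite: Burgisser2000, (2.1)] -/
theorem complexity_detPoly_le_of_nc {n s : ℕ} (h : HasNcCircuitSizeLE (ncDetPoly ℂ n) s) :
    complexity (detPoly (Fin n) ℂ) ≤ s := by
  simpa [commImage_ncDetPoly] using h.complexity_le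

/-! ## §2 Pieces of the determinant face (over `ℂ`) -/

/-- PIECE `NcDetHard` — THE CAYLEY DETERMINANT HAS NO POLYNOMIAL-SIZE NONCOMMUTATIVE CIRCUITS (i.o.
form): for every exponent `c` some order `n` admits no fan-in-two nc circuit of size `≤ n^c + c`.
TAG: WEAKER·NECESSARY modulo `AS10_thm_10` (`ncDetHard_of_vh`); commutative shadow FALSE; OPEN
(AS10 §1). [cite: ArvindSrinivasan2010, §4 Thm 10] -/
@[conjecture] def NcDetHard : Prop :=
  ∀ c : ℕ, ∃ n : ℕ, ¬ HasNcCircuitSizeLE (ncDetPoly ℂ n) (n ^ c + c)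

/-- RESIDUAL `DetLift`: if `VP_ℂ = VNP_ℂ` then the Cayley determinants have fan-in-two noncommutative
circuits of polynomial size (a.e.). TAG: DECLARED-RESIDUAL · vacuous under `S` · EXACT
(`detLift_iff_residual`) · STRONGER than `NcLift` (`ncLift_of_detLift`) · IDEA-NEEDED.
[cite: ArvindSrinivasan2010, §1] -/
@[conjecture] def DetLift : Prop :=
  VP ℂ = VNP ℂ → ∃ c : ℕ, ∀ n : ℕ, HasNcCircuitSizeLE (ncDetPoly ℂ n) (n ^ c + c)

/-- Growth bookkeeping: `((2n)^c + c + n + 2)^e` is polynomially bounded. [cite: Burgisser2000, Def. 2.1] -/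
theorem isPBounded_detToPerBound (c e : ℕ) :
    IsPBounded fun n => ((2 * n) ^ c + c + n + 2) ^ e := by
  refine IsPBounded.pow_holds ?_ e
  refine (IsPBounded.iff_exists_le_mul_succ_pow _).2 ⟨2 ^ c + c + 3, c + 1, fun n => ?_⟩
  have h1 : (2 * n) ^ c ≤ 2 ^ c * (n + 1) ^ (c + 1) := by
    rw [mul_pow]
    refine Nat.mul_le_mul_left _ ?_
    exact (Nat.pow_le_pow_left (Nat.le_succ n) c).trans (Nat.pow_le_pow_right (Nat.succ_pos n) (Nat.le_succ c))
  have h2 : 1 ≤ (n + 1) ^ (c + 1) := Nat.one_le_pow _ _ (Nat.succ_pos n)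
  have h3 : n + 2 ≤ 3 * (n + 1) ^ (c + 1) := by
    have : n + 1 ≤ (n + 1) ^ (c + 1) := by
      calc n + 1 = (n + 1) ^ 1 := (pow_one _).symm
        _ ≤ (n + 1) ^ (c + 1) := Nat.pow_le_pow_right (Nat.succ_pos n) (by omega)
    omega
  nlinarith

/-- **Poly nc circuits for the Cayley determinants ⟹ poly nc circuits for the Cayley permanents**, given
the fact (use order `2n` for order `n`). [cite: ArvindSrinivasan2010, §4 Thm 10] -/
theorem perEasy_of_detEasy (hAS : AS10_thm_10 ℂ)
    (h : ∃ c : ℕ, ∀ n : ℕ, HasNcCircuitSizeLE (ncDetPoly ℂ n) (n ^ c + c)) :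
    ∃ c : ℕ, ∀ n : ℕ, HasNcCircuitSizeLE (ncPerPoly ℂ n) (n ^ c + c) := by
  obtain ⟨e, he⟩ := hAS
  obtain ⟨c, hc⟩ := h
  obtain ⟨c', hc'⟩ := isPBounded_detToPerBound c e
  refine ⟨c', fun n => ?_⟩
  have h1 := he n _ (hc (2 * n))
  exact h1.mono ((Nat.pow_le_pow_left (by omega) e).trans (hc' n))

/-- **`A_nc ⟹ NcDetHard`** given the fact. [cite: ArvindSrinivasan2010, §4 Thm 10] -/
theorem ncDetHard_of_perNotNcVP (hAS : AS10_thm_10 ℂ) (hA : NcSemantics.PerNotNcVP) : NcDetHard := by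
  rw [NcLiteratureBridge.perNotNcVP_iff] at hA
  by_contra hD
  simp only [NcDetHard, not_forall, not_exists, not_not] at hD
  obtain ⟨c, hc⟩ := perEasy_of_detEasy hAS hD
  obtain ⟨n, hn⟩ := hA c
  exact hn (hc n)

/-- **NECESSITY (modulo the fact): `S ⟹ NcDetHard`** — `VP ≠ VNP` forces the Cayley determinant to be
hard for noncommutative circuits (`S ⟹ A_nc` kernel, `A_nc ⟹ NcDetHard` by AS10).
[cite: ArvindSrinivasan2010, §4 Thm 10] -/
theorem ncDetHard_of_vh (hAS : AS10_thm_10 ℂ) (hS : _root_.ValiantsHypothesis) : NcDetHard :=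
  ncDetHard_of_perNotNcVP hAS (NcSemantics.perNotNcVP_of_vh hS)

/-! ## §3 The determinant residual and the exact split -/

/-- NODE: `S ⟸ NcDetHard ∧ DetLift`. [cite: ArvindSrinivasan2010, §1] -/
theorem closes_det (hA : NcDetHard) (hB : DetLift) : _root_.ValiantsHypothesis := by
  intro heq
  obtain ⟨c, hc⟩ := hB heq
  obtain ⟨n, hn⟩ := hA c
  exact hn (hc n)

/-- `DetLift` is (vacuously) implied by `S`. [cite: ArvindSrinivasan2010, §1] -/
theorem detLift_of_vh (hS : _root_.ValiantsHypothesis) : DetLift := fun heq => absurd heq hS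

/-- `DetLift` is EXACTLY the residual of `NcDetHard`. [cite: ArvindSrinivasan2010, §1] -/
theorem detLift_iff_residual : DetLift ↔ (NcDetHard → _root_.ValiantsHypothesis) := by
  refine ⟨fun hB hA => closes_det hA hB, fun h heq => ?_⟩
  by_contra hE
  refine h (fun c => ?_) heq
  by_contra hc
  simp only [not_exists, not_not] at hc
  exact hE ⟨c, hc⟩

/-- EXACT CONJUNCT SPLIT (modulo the fact): `S ⟺ NcDetHard ∧ DetLift`. [cite: ArvindSrinivasan2010, §4 Thm 10] -/
theorem summit_iff_det_split (hAS : AS10_thm_10 ℂ) :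
    _root_.ValiantsHypothesis ↔ NcDetHard ∧ DetLift :=
  ⟨fun hS => ⟨ncDetHard_of_vh hAS hS, detLift_of_vh hS⟩, fun h => closes_det h.1 h.2⟩

/-- ZERO-SUM BOOKKEEPING: the determinant residual implies the permanent residual `B_nc = NcLift`
(given the fact) — `DetLift` is the stronger residual, as `NcDetHard` is the weaker piece.
[cite: ArvindSrinivasan2010, §4 Thm 10] -/
theorem ncLift_of_detLift (hAS : AS10_thm_10 ℂ) (hB : DetLift) : NcSemantics.NcLift := by
  rw [NcLiteratureBridge.ncLift_iff]
  exact fun heq => perEasy_of_detEasy hAS (hB heq)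

/-- The one mixed edge that holds: `A_nc ∧ DetLift ⟹ S` given the fact. [cite: ArvindSrinivasan2010, §4 Thm 10] -/
theorem vh_of_perNotNcVP_detLift (hAS : AS10_thm_10 ℂ) (hA : NcSemantics.PerNotNcVP) (hB : DetLift) :
    _root_.ValiantsHypothesis :=
  closes_det (ncDetHard_of_perNotNcVP hAS hA) hB

end Summit.ValiantsHypothesis.ValiantsHypothesis.Theorems.NcDeterminantFace

end
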